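import Literature.MathematicalPhysics.QuantumFieldTheory.PlaquetteSystemPolymerExpansion
import Literature.Probability.LatticeModels.ClusterExpansionKPBound
import Literature.Probability.LatticeModels.AnchoredClusterExpansion
import HarnessLib

/-!
# Two families of plaquette weights with the same small-polymer activities on an ABSTRACT plaquette–link system:
# `|ln Z₁ - ln Z₂| ≤ 2·#P·e^{-A}`, twist transport by central link multiplications, translates invisible to small polymers

Topic `Literature/MathematicalPhysics/QuantumFieldTheory`; vocabulary of `PlaquetteSystemPolymers.lean` / `PlaquetteSystemPolymerExpansion.lean`
(`S : PlaquetteSystem P E G`; `twistFamily t w`; `S.polymerActivity`, `S.Z`; Kotecký–Preiss smallness from a degree bound `#(S.nbrs p) ≤ Δ`)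
and of the abstract cluster-expansion layer `Literature.Probability.LatticeModels.{ClusterExpansion, ClusterExpansionKPBound,
AnchoredClusterExpansion}`.  THEOREMS ONLY: the `Agree` section of `PlaquetteFieldTwistBound.lean` (symmetric torus, threshold `L²`)
redone for an arbitrary finite plaquette–link system and an arbitrary size threshold `A`, plus the two geometry-free ingredients of
twist locality — E. T. Tomboulis, arXiv:0707.2179 [Tomboulis2007Confinement] §4 (moving the coclosed set `𝒱` by a coboundary = a
change of variables on the cobounding bonds) and §6.2 (6.10)–(6.12) (only clusters with a large polymer survive in `ln Z⁻ - ln Z`);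
K. R. Ito, E. Seiler, arXiv:0803.3019 [ItoSeiler2008Further] Thm 2.2 (1); R. Kotecký, D. Preiss, CMP 103 (1986) 491 [KoteckyPreiss1986].

* `polymerLogZ_sub_polymerLogZ_eq_of_agree`, `sum_norm_truncatedWeight_le_of_large`, ★ `abs_log_Z_sub_log_Z_le_of_agree`,
  `one_sub_Z_div_le_of_agree` — for two measurable families in the KP region whose polymer activities agree on polymers with
  fewer than `A` plaquettes: `|ln Z₁ - ln Z₂| ≤ 2·#P·e^{-A}`;
* `measurePreserving_mul_links`, ★ `polymerActivity_twistFamily_eq_of_mul_links`, `Z_twistFamily_eq_of_mul_links` — TRANSPORT: if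
  `hol (c·U) p = σ_p · hol U p` (for central `c`, `σ = δc`), the families twisted by `t` and by `t·σ` have the same polymer activities
  at EVERY plaquette set (and the same `Z`);
* ★ `polymerActivity_twistFamily_eq_of_translates` — insertions living on pairwise disjoint translates `T i` (`i : ι`) with equal
  polymer activities are invisible to plaquette sets with fewer than `#ι` plaquettes (pigeonhole).

HONEST FRAMING: finite-volume identities and bounds; nothing about large `β` or any limit.  The anisotropic-box instance (where
`#ι = n₀ n₁` is the area of the twisted plane, independent of the transverse extents) is `FinTorusPlaquetteSystem.lean` /
`FinTorusStackTwistLocality.lean`.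
-/

noncomputable section

open MeasureTheory Finset
open scoped BigOperators
open Literature.Probability.LatticeModels (IsRConnected GeomInc Touches)

namespace Literature.MathematicalPhysics.QuantumFieldTheory

namespace PlaquetteSystem

variable {P E G : Type*} (S : PlaquetteSystem P E G)

/-! ## Two families with the same small-polymer activities -/

section Agree

variable [Fintype E] [DecidableEq E] [Group G] [TopologicalSpace G] [IsTopologicalGroup G] [CompactSpace G]
  [MeasurableSpace G] [BorelSpace G] [Fintype P] [DecidableEq P]

open Literature.Probability.LatticeModels

omit [Fintype E] [DecidableEq E] [Group G] [TopologicalSpace G] [IsTopologicalGroup G] [CompactSpace G]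
  [MeasurableSpace G] [BorelSpace G] [Fintype P] [DecidableEq P] in
/-- Covering bound (plumbing). [folklore] -/
private theorem sum_le_sum_sum_of_cover {ι κ : Type*} [DecidableEq ι] (𝒞 : Finset ι) (Q : Finset κ)
    (T : κ → Finset ι) {g : ι → ℝ} (hg : ∀ C, 0 ≤ g C) (hcover : ∀ C ∈ 𝒞, ∃ p ∈ Q, C ∈ T p) :
    ∑ C ∈ 𝒞, g C ≤ ∑ p ∈ Q, ∑ C ∈ T p, g C := by
  classical
  calc ∑ C ∈ 𝒞, g C ≤ ∑ C ∈ 𝒞, ∑ p ∈ Q with C ∈ T p, g C := by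
        refine Finset.sum_le_sum fun C hC => ?_
        obtain ⟨p, hp, hR⟩ := hcover C hC
        rw [Finset.sum_const, nsmul_eq_mul]
        have h1 : (1 : ℝ) ≤ (Q.filter fun p => C ∈ T p).card := by
          exact_mod_cast Finset.card_pos.2 ⟨p, Finset.mem_filter.2 ⟨hp, hR⟩⟩
        nlinarith [hg C]
    _ = ∑ p ∈ Q, ∑ C ∈ 𝒞 with C ∈ T p, g C := by
        rw [Finset.sum_comm' (t' := Q) (s' := fun p => 𝒞.filter fun C => C ∈ T p)]
        intro C p
        simp only [Finset.mem_filter]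
        tauto
    _ ≤ ∑ p ∈ Q, ∑ C ∈ T p, g C := Finset.sum_le_sum fun p _ =>
        Finset.sum_le_sum_of_subset_of_nonneg (fun C hC => (Finset.mem_filter.1 hC).2) fun C _ _ => hg C

/-- **(6.10) for two families with the same small-polymer activities**: their Kotecký–Preiss logarithms differ only by
the truncated functionals of clusters containing a polymer with at least `A` plaquettes.
[cite: Tomboulis2007Confinement, §6.2 eq. (6.10)] [cite: KoteckyPreiss1986, (2) and Proposition p. 494 (i)] -/
theorem polymerLogZ_sub_polymerLogZ_eq_of_agree {w₁ w₂ : P → G → ℝ} {A : ℕ}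
    (hagree : ∀ X : Finset P, X.card < A → S.polymerActivity w₁ X = S.polymerActivity w₂ X) :
    polymerLogZ (GeomInc S.linkRel) (S.polymerActivity w₁) S.polymers -
        polymerLogZ (GeomInc S.linkRel) (S.polymerActivity w₂) S.polymers =
      ∑ C ∈ S.polymers.powerset with (C ∩ S.polymers.filter fun X => A ≤ X.card).Nonempty,
        (truncatedWeight (GeomInc S.linkRel) (S.polymerActivity w₁) C -
          truncatedWeight (GeomInc S.linkRel) (S.polymerActivity w₂) C) := by
  refine polymerLogZ_sub_eq_sum_filter _ _ fun γ hγ hγT => ?_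
  have hlt : γ.card < A := by
    by_contra h
    exact hγT (Finset.mem_filter.2 ⟨hγ, not_lt.1 h⟩)
  exact hagree γ hlt

/-- The tail estimate for a family of clusters each containing a polymer with `≥ A` plaquettes (any compact group, any
family of weights in the Kotecký–Preiss region, any finite plaquette–link system).
[cite: KoteckyPreiss1986, Theorem p. 492, estimate (4)] -/
theorem sum_norm_truncatedWeight_le_of_large {Δ : ℕ} (hΔ : ∀ p, (S.nbrs p).card ≤ Δ) {w : P → G → ℝ} {ε : ℝ}
    (hε : ∀ p W, |w p W - 1| ≤ ε) (hsmall : ((Δ : ℝ) + 1) ^ 2 * (Real.exp 2 * ε) ≤ 1 / 2) {A : ℕ}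
    (𝒞 : Finset (Finset (Finset P))) (hlarge : ∀ C ∈ 𝒞, ∃ X ∈ C, X ∈ S.polymers ∧ A ≤ X.card) :
    ∑ C ∈ 𝒞, ‖truncatedWeight (GeomInc S.linkRel) (S.polymerActivity w) C‖ ≤
      (Fintype.card P : ℝ) * Real.exp (-(A : ℝ)) := by
  classical
  haveI : Std.Refl (GeomInc S.linkRel) := ⟨geomInc_refl _⟩
  haveI : Std.Symm (GeomInc S.linkRel) := ⟨fun _ _ h => geomInc_symm _ S.linkRel_symm h⟩
  have hfact := koteckyPreiss_truncatedWeight_bound_holds (GeomInc S.linkRel) (S.polymerActivity w)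
    (fun X : Finset P => (X.card : ℝ)) (fun X : Finset P => (X.card : ℝ))
  have h1 := S.kp_hypothesis_polymerActivity_tsum hΔ hε hsmall
  have hsize : ∀ C ∈ 𝒞, ((A : ℝ)) ≤ ∑ γ' ∈ C, ((γ'.card : ℕ) : ℝ) := by
    intro C hC
    obtain ⟨X, hXC, -, hXA⟩ := hlarge C hC
    have h := Finset.single_le_sum (f := fun γ' : Finset P => ((γ'.card : ℕ) : ℝ)) (fun γ' _ => Nat.cast_nonneg _) hXC
    exact le_trans (by exact_mod_cast hXA) h
  have hstep := fun p : P => sum_norm_truncatedWeight_le_exp_neg_of_touches hfact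
    (fun _ => Nat.cast_nonneg _) (fun _ => Nat.cast_nonneg _) h1 𝒞 {p} (r := (A : ℝ))
    (fun C hC _ => hsize C hC)
  have hsum := Finset.sum_le_sum fun p (_ : p ∈ (Finset.univ : Finset P)) => hstep p
  refine ((sum_le_sum_sum_of_cover 𝒞 Finset.univ _ (fun C => norm_nonneg _) ?_).trans hsum).trans (le_of_eq ?_)
  · intro C hC
    obtain ⟨X, hXC, hXP, -⟩ := hlarge C hC
    obtain ⟨p, hp⟩ := S.nonempty_of_mem_polymers hXP
    exact ⟨p, Finset.mem_univ _, Finset.mem_filter.2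
      ⟨hC, X, hXC, Or.inr ⟨p, hp, p, Finset.mem_singleton_self p, Or.inl rfl⟩⟩⟩
  · simp only [Finset.card_singleton, Nat.cast_one, mul_one, Finset.sum_const, Finset.card_univ, nsmul_eq_mul]

/-- **★ `|ln Z₁ - ln Z₂| ≤ 2 · #plaquettes · e^{-A}`** for two measurable families in the Kotecký–Preiss region whose
polymer activities agree on every polymer with fewer than `A` plaquettes (arXiv:0707.2179 (6.10)–(6.12): only clusters
with a polymer of size `≥ A` survive in the difference of the logarithms), on any finite plaquette–link system.
[cite: Tomboulis2007Confinement, §6.2 eqs. (6.10)–(6.12)] [cite: KoteckyPreiss1986, Theorem p. 492, estimate (4)] -/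
theorem abs_log_Z_sub_log_Z_le_of_agree (hhol : ∀ p, Measurable fun U : E → G => S.hol U p) {Δ : ℕ}
    (hΔ : ∀ p, (S.nbrs p).card ≤ Δ) {w₁ w₂ : P → G → ℝ} (hw₁ : ∀ p, Measurable (w₁ p))
    (hw₂ : ∀ p, Measurable (w₂ p)) {ε : ℝ} (hε₁ : ∀ p W, |w₁ p W - 1| ≤ ε) (hε₂ : ∀ p W, |w₂ p W - 1| ≤ ε)
    (hsmall : ((Δ : ℝ) + 1) ^ 2 * (Real.exp 2 * ε) ≤ 1 / 2) {A : ℕ}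
    (hagree : ∀ X : Finset P, X.card < A → S.polymerActivity w₁ X = S.polymerActivity w₂ X) :
    |Real.log (S.Z w₁) - Real.log (S.Z w₂)| ≤ 2 * (Fintype.card P : ℝ) * Real.exp (-(A : ℝ)) := by
  set ℓ₁ := polymerLogZ (GeomInc S.linkRel) (S.polymerActivity w₁) S.polymers with hℓ₁
  set ℓ₂ := polymerLogZ (GeomInc S.linkRel) (S.polymerActivity w₂) S.polymers with hℓ₂
  have hlog₁ : Real.log (S.Z w₁) = ℓ₁.re := S.log_Z_eq_re_polymerLogZ hhol hΔ hw₁ hε₁ hsmall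
  have hlog₂ : Real.log (S.Z w₂) = ℓ₂.re := S.log_Z_eq_re_polymerLogZ hhol hΔ hw₂ hε₂ hsmall
  have hl : ∀ C ∈ S.polymers.powerset.filter (fun C => (C ∩ S.polymers.filter fun X => A ≤ X.card).Nonempty),
      ∃ X ∈ C, X ∈ S.polymers ∧ A ≤ X.card := by
    intro C hC
    obtain ⟨X, hX⟩ := (Finset.mem_filter.1 hC).2
    rw [Finset.mem_inter, Finset.mem_filter] at hX
    exact ⟨X, hX.1, hX.2.1, hX.2.2⟩
  calc |Real.log (S.Z w₁) - Real.log (S.Z w₂)|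
      = |(ℓ₁ - ℓ₂).re| := by rw [Complex.sub_re, hlog₁, hlog₂]
    _ ≤ ‖ℓ₁ - ℓ₂‖ := Complex.abs_re_le_norm _
    _ = ‖∑ C ∈ S.polymers.powerset with (C ∩ S.polymers.filter fun X => A ≤ X.card).Nonempty,
          (truncatedWeight (GeomInc S.linkRel) (S.polymerActivity w₁) C -
            truncatedWeight (GeomInc S.linkRel) (S.polymerActivity w₂) C)‖ := by
        rw [hℓ₁, hℓ₂, S.polymerLogZ_sub_polymerLogZ_eq_of_agree hagree]
    _ ≤ ∑ C ∈ S.polymers.powerset with (C ∩ S.polymers.filter fun X => A ≤ X.card).Nonempty,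
          (‖truncatedWeight (GeomInc S.linkRel) (S.polymerActivity w₁) C‖ +
            ‖truncatedWeight (GeomInc S.linkRel) (S.polymerActivity w₂) C‖) :=
        (norm_sum_le _ _).trans (Finset.sum_le_sum fun C _ => norm_sub_le _ _)
    _ ≤ (Fintype.card P : ℝ) * Real.exp (-(A : ℝ)) + (Fintype.card P : ℝ) * Real.exp (-(A : ℝ)) := by
        rw [Finset.sum_add_distrib]
        exact add_le_add (S.sum_norm_truncatedWeight_le_of_large hΔ hε₁ hsmall _ hl)
          (S.sum_norm_truncatedWeight_le_of_large hΔ hε₂ hsmall _ hl)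
    _ = 2 * (Fintype.card P : ℝ) * Real.exp (-(A : ℝ)) := by ring

/-- **`1 - Z₂/Z₁ ≤ 2 · #plaquettes · e^{-A}`** for two families as in `abs_log_Z_sub_log_Z_le_of_agree` (`1 - x ≤ -ln x`).
[cite: Tomboulis2007Confinement, §6.2 eqs. (6.10)–(6.12)] [cite: ItoSeiler2008Further, §2 Thm 2.2 (1)] -/
theorem one_sub_Z_div_le_of_agree (hhol : ∀ p, Measurable fun U : E → G => S.hol U p) {Δ : ℕ}
    (hΔ : ∀ p, (S.nbrs p).card ≤ Δ) {w₁ w₂ : P → G → ℝ} (hw₁ : ∀ p, Measurable (w₁ p))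
    (hw₂ : ∀ p, Measurable (w₂ p)) {ε : ℝ} (hε₁ : ∀ p W, |w₁ p W - 1| ≤ ε) (hε₂ : ∀ p W, |w₂ p W - 1| ≤ ε)
    (hsmall : ((Δ : ℝ) + 1) ^ 2 * (Real.exp 2 * ε) ≤ 1 / 2) {A : ℕ}
    (hagree : ∀ X : Finset P, X.card < A → S.polymerActivity w₁ X = S.polymerActivity w₂ X) :
    1 - S.Z w₂ / S.Z w₁ ≤ 2 * (Fintype.card P : ℝ) * Real.exp (-(A : ℝ)) := by
  have hZ₁ := S.Z_pos_of_kpSmall hhol hw₁ hε₁ hsmall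
  have hZ₂ := S.Z_pos_of_kpSmall hhol hw₂ hε₂ hsmall
  have hratio : 0 < S.Z w₂ / S.Z w₁ := div_pos hZ₂ hZ₁
  calc 1 - S.Z w₂ / S.Z w₁ ≤ -Real.log (S.Z w₂ / S.Z w₁) := by
        linarith [Real.log_le_sub_one_of_pos hratio]
    _ = Real.log (S.Z w₁) - Real.log (S.Z w₂) := by
        rw [Real.log_div hZ₂.ne' hZ₁.ne']
        ring
    _ ≤ |Real.log (S.Z w₁) - Real.log (S.Z w₂)| := le_abs_self _
    _ ≤ 2 * (Fintype.card P : ℝ) * Real.exp (-(A : ℝ)) :=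
        S.abs_log_Z_sub_log_Z_le_of_agree hhol hΔ hw₁ hw₂ hε₁ hε₂ hsmall hagree

end Agree

/-! ## Moving an insertion by a central link multiplication (twist transport) -/

section Transport

variable [Fintype E] [Group G] [TopologicalSpace G] [IsTopologicalGroup G] [CompactSpace G]
  [MeasurableSpace G] [BorelSpace G]

/-- **Multiplying every link variable on the left by a fixed group element preserves the product Haar measure**
(left invariance of Haar measure, link by link: the change of variables `U_b → (-𝟙)U_b` of arXiv:0707.2179 §4).
[cite: Tomboulis2007Confinement, §4 (text after eq. (4.1))] -/
theorem measurePreserving_mul_links (c : E → G) :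
    MeasurePreserving (fun U : E → G => fun e => c e * U e)
      (Measure.pi fun _ : E => haarProbability G) (Measure.pi fun _ : E => haarProbability G) :=
  measurePreserving_pi (f := fun (e : E) (x : G) => c e * x)
    (fun _ : E => haarProbability G) (fun _ : E => haarProbability G)
    fun e => measurePreserving_mul_left (haarProbability G) (c e)

omit [Fintype E] [CompactSpace G] in
/-- The link multiplication is a measurable embedding (indeed a measurable equivalence, inverse `c⁻¹ · `). [folklore] -/
private theorem measurableEmbedding_mul_links (c : E → G) :
    MeasurableEmbedding (fun U : E → G => fun e => c e * U e) :=
  (MeasurableEquiv.piCongrRight fun e : E => MeasurableEquiv.mulLeft (c e)).measurableEmbedding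

/-- **Twist transport.**  If the link multiplication `U ↦ c · U` multiplies every plaquette variable by `σ_p`
(`hol (c·U) p = σ_p · hol U p`; for central `c` this `σ = δc` is the plaquette coboundary of `c`), then the family
twisted by `t` and the family twisted by `t · σ` have THE SAME polymer activity at EVERY plaquette set: the substitution
`U ↦ c · U` in the Haar integral (arXiv:0707.2179 §4: "`𝒱` and `𝒱'` are homologous … cobound a set of bonds … the
change of variables `U_b → (-𝟙)U_b` on these bonds").  [cite: Tomboulis2007Confinement, §4 (text after eq. (4.1))] -/
theorem polymerActivity_twistFamily_eq_of_mul_links (c : E → G) {σ : P → G}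
    (hc : ∀ (U : E → G) (p : P), S.hol (fun e => c e * U e) p = σ p * S.hol U p) (t : P → G) (w : P → G → ℝ)
    (X : Finset P) :
    S.polymerActivity (twistFamily t w) X = S.polymerActivity (twistFamily (fun p => t p * σ p) w) X := by
  by_cases hX : Literature.Probability.LatticeModels.IsRConnected S.linkRel X
  · rw [S.polymerActivity_of_isRConnected hX, S.polymerActivity_of_isRConnected hX]
    congr 1
    have h := (measurePreserving_mul_links c).integral_comp (measurableEmbedding_mul_links c)
      (fun U : E → G => ∏ p ∈ X, S.activity (twistFamily t w) U p)
    rw [← h]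
    refine integral_congr_ae (ae_of_all _ fun U => ?_)
    refine Finset.prod_congr rfl fun p _ => ?_
    simp only [activity, twistFamily, hc U p, mul_assoc]
  · rw [S.polymerActivity_of_not_isRConnected hX, S.polymerActivity_of_not_isRConnected hX]

variable [Fintype P]

/-- The same transport for the partition functions: `Z(w twisted by t) = Z(w twisted by t·σ)`.
[cite: Tomboulis2007Confinement, §4 (text after eq. (4.1))] -/
theorem Z_twistFamily_eq_of_mul_links (c : E → G) {σ : P → G}
    (hc : ∀ (U : E → G) (p : P), S.hol (fun e => c e * U e) p = σ p * S.hol U p) (t : P → G) (w : P → G → ℝ) :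
    S.Z (twistFamily t w) = S.Z (twistFamily (fun p => t p * σ p) w) := by
  unfold Z
  have h := (measurePreserving_mul_links c).integral_comp (measurableEmbedding_mul_links c)
    (fun U : E → G => ∏ p : P, twistFamily t w p (S.hol U p))
  rw [← h]
  refine integral_congr_ae (ae_of_all _ fun U => ?_)
  refine Finset.prod_congr rfl fun p _ => ?_
  simp only [twistFamily, hc U p, mul_assoc]

end Transport

/-! ## Insertions invisible to small polymers: pairwise disjoint translates -/

section Translates

variable [Fintype E] [Group G] [TopologicalSpace G] [IsTopologicalGroup G] [CompactSpace G]
  [MeasurableSpace G] [BorelSpace G]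

omit [Fintype E] [Group G] [TopologicalSpace G] [IsTopologicalGroup G] [CompactSpace G] [MeasurableSpace G]
  [BorelSpace G] in
/-- **Pigeonhole**: a set meeting every member of a family of pairwise disjoint sets indexed by `ι` has at least `#ι`
elements; hence a set with fewer than `#ι` elements misses one of them. [folklore] -/
private theorem exists_disjoint_of_card_lt {ι : Type*} [Fintype ι] {T : ι → Finset P}
    (hT : ∀ i j, i ≠ j → Disjoint (T i) (T j)) {X : Finset P} (hX : X.card < Fintype.card ι) :
    ∃ i, Disjoint X (T i) := by
  classical
  by_contra h
  have hch : ∀ i, ∃ p, p ∈ X ∧ p ∈ T i := fun i => by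
    have : ¬ Disjoint X (T i) := fun hi => h ⟨i, hi⟩
    rw [Finset.not_disjoint_iff] at this
    exact this
  choose f hfX hfT using hch
  have hinj : Function.Injective f := fun i j hij => by
    by_contra hne
    exact Finset.disjoint_left.1 (hT i j hne) (hfT i) (hij ▸ hfT j)
  have hle : Fintype.card ι ≤ X.card := by
    calc Fintype.card ι = (Finset.univ.image f).card := (Finset.card_image_of_injective _ hinj).symm
      _ ≤ X.card := Finset.card_le_card (Finset.image_subset_iff.2 fun i _ => hfX i)
  exact absurd hX (not_lt.2 hle)

/-- **Insertions on pairwise disjoint translates with equal polymer activities are invisible to small polymers.**  If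
the insertions `t i` (`i : ι`) are trivial off pairwise disjoint plaquette sets `T i`, and all the twisted families have the
same polymer activities (e.g. by `polymerActivity_twistFamily_eq_of_mul_links`: the translates are homologous), then
on every plaquette set with fewer than `#ι` plaquettes each twisted family has the UNTWISTED polymer activity
(arXiv:0707.2179 §6.2 before (6.10): "for any `Y` such that … one has `z⁻(Y) = z(Y)`"; the size threshold is the number
of translates, independent of the extent of the system in the other directions).
[cite: Tomboulis2007Confinement, §6.2 eqs. (6.10)–(6.11)] -/
theorem polymerActivity_twistFamily_eq_of_translates {ι : Type*} [Fintype ι] {T : ι → Finset P}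
    (hT : ∀ i j, i ≠ j → Disjoint (T i) (T j)) {t : ι → P → G} (ht : ∀ i p, p ∉ T i → t i p = 1)
    (w : P → G → ℝ)
    (hall : ∀ i j (X : Finset P), S.polymerActivity (twistFamily (t i) w) X = S.polymerActivity (twistFamily (t j) w) X)
    (i : ι) {X : Finset P} (hX : X.card < Fintype.card ι) :
    S.polymerActivity (twistFamily (t i) w) X = S.polymerActivity w X := by
  obtain ⟨j, hj⟩ := exists_disjoint_of_card_lt hT hX
  rw [hall i j X]
  exact S.polymerActivity_twistFamily_of_eq_one w fun p hp => ht j p (Finset.disjoint_left.1 hj hp)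

end Translates

end PlaquetteSystem

end Literature.MathematicalPhysics.QuantumFieldTheory

end
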